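import Summits.Ventures.PercRepro.Night2LineHitUp
import Summits.Ventures.PercRepro.Night2SmallCells

/-!
# night-2: THE TOP LEVELS PLUS THE LEVEL-SEVEN LINE TARGETS — `|W| = 11` closes; h21's cell `(2, 1)` for `|G| ≥ 17` (gen 39)

Two DISJOINT families: (A) all the targets of the top four levels (`|Y| ≥ N − 3`, unloaded when every line carries `≤ L ≤ N − 6`
points of `W`, `vCap = 1`: income `topIncome N := Σ_{i=N−3}^{N} C(N, i) · 3 / C(i + 5, 4)`), and (B) the level-seven targets of a
line `cl {x, y}` with four line points and three hitting off-line points (`line_hit_term`: income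
`levelSevenIncome q d k := C(d, 4) · (11/18) · (C(k, 3) − 3 C(k − 2, 3))⁺ · 3 / lineFaceBound (4 + q) (8 − q)`), for `N ≥ 11`.
**`basis_pair_fair_of_top_and_level_seven`**: `1 ≤ topIncome N + levelSevenIncome q d k` ⇒ fair.  The cell `(5, 6)` at `N = 11`:
`0.883 + 0.159 / 0.175 / 0.204` (`basis_pair_fair_of_five_six_eleven`).  With the other cells of `N = 11` (at most four collinear
points: Night2HighTop; a longest line of six points: Night2LineHitUp; seven collinear points: Night2SmallCells):
**`basis_pair_fair_of_eleven`**, **`localShadowHall_nonfat_of_seventeen`**, **`localShadowHall_two_one_of_seventeen`** —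
h21's cell `(2, 1)` for every `|G| ≥ 17`.  Paper: proofs/NIGHT-2-g39.md §5.
-/

namespace PercRepro.Shadow

open PercRepro.ThmH PercRepro.PerFlat

variable {α : Type*} [DecidableEq α] {M : Matroid α} [M.Finite] {G : Finset α}

/-- The income of the top four levels at full capacity: `Σ_{i=N−3}^{N} C(N, i) · 3 / C(i + 5, 4)`. -/
noncomputable def topIncome (N : ℕ) : ℚ :=
  ∑ i ∈ Finset.range (N + 1), if N ≤ i + 3 then ((N.choose i : ℕ) : ℚ) * (3 / (((i + 5).choose 4 : ℕ) : ℚ)) else 0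

/-- The income of the level-seven line targets: `C(d, 4) · (11/18) · (C(k, 3) − 3 C(k − 2, 3))⁺ · 3 / lineFaceBound (4 + q) (8 − q)`. -/
noncomputable def levelSevenIncome (q d k : ℕ) : ℚ :=
  ((d.choose 4 : ℕ) : ℚ) * (11 / 18 * max 0 (((k.choose 3 : ℕ) : ℚ) - 3 * (((k - 2).choose 3 : ℕ) : ℚ)) * 3 /
    ((lineFaceBound (4 + q) (8 - q) : ℕ) : ℚ))

/-- **The top family and the level-seven line family**: disjoint sub-families of the targets whose incomes are at least
`topIncome N` and `levelSevenIncome q d k`. -/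
theorem top_and_level_seven_income (hG : G ∈ flatsQ M (5 + 1)) (hd : (gr M \ G).card = 2)
    (hk : kColoops M G = 1) (hs : ∀ e ∈ gr M, ∀ f ∈ gr M, e ≠ f → rkN M {e, f} = 2)
    (hl : ∀ e ∈ gr M, M.Indep {e}) (hnf : fatClosures M 5 G 2 = ∅) {B : Finset α}
    (hB : B ∈ thinMembers M 5 G) (hnP : ¬ bigP M G B) {z : α} (hz : z ∈ G \ clF M B)
    (hl0 : loss M 5 G B z ≠ 0) {L : ℕ} (hL1 : 1 ≤ L)
    (hL : ∀ x ∈ G \ insert z B, ∀ y ∈ G \ insert z B, x ≠ y →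
      ((G \ insert z B) ∩ clF M {x, y}).card ≤ L)
    (hLN : L + 6 ≤ (G \ insert z B).card) (hN : 11 ≤ (G \ insert z B).card)
    {x y : α} (hx : x ∈ G \ coloops M G) (hy : y ∈ G \ coloops M G) (hxy : x ≠ y) :
    ∃ 𝒯 ⊆ tgtSets M 5 G B z,
      topIncome (G \ insert z B).card + levelSevenIncome ((insert z B \ coloops M G) ∩ clF M {x, y}).card
        ((G \ insert z B) ∩ clF M {x, y}).card ((G \ insert z B) \ clF M {x, y}).card ≤
      ∑ T ∈ 𝒯, vCap M G T / faceSum M G T := by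
  have hQG : insert z B ⊆ G :=
    Finset.insert_subset (Finset.mem_sdiff.1 hz).1 (subset_G_of_mem_thinMembers hB)
  have hL' := lines_le_of_pairs_le hs hG hL1 hL
  have hA3 := card_filter_line_faces_le_three hG hd hk hs hB hnP hz hx hy hxy
  -- family A: the top four levels
  set famA : Finset (Finset α) := (G \ insert z B).powerset.filter
    (fun Y => (G \ insert z B).card ≤ Y.card + 3) with hfamA
  set 𝒯A : Finset (Finset α) := famA.image (fun Y => insert z B ∪ Y) with h𝒯A
  have hmemA : ∀ Y ∈ famA, Y ⊆ G \ insert z B ∧ (G \ insert z B).card ≤ Y.card + 3 := fun Y hY => by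
    rw [hfamA, Finset.mem_filter, Finset.mem_powerset] at hY
    exact hY
  have h𝒯Asub : 𝒯A ⊆ tgtSets M 5 G B z := by
    intro T hT
    rw [h𝒯A, Finset.mem_image] at hT
    obtain ⟨Y, hY, rfl⟩ := hT
    obtain ⟨hYW, hYc⟩ := hmemA Y hY
    rw [tgtSets_eq_image hG (mem_thinMembers.1 hB).1 hz, Finset.mem_image]
    refine ⟨Y, Finset.mem_filter.2 ⟨Finset.mem_powerset.2 hYW, ?_⟩, rfl⟩
    rw [← Finset.card_pos]
    omega
  have hrecA : ∀ Y ⊆ G \ insert z B, (insert z B ∪ Y) ∩ (G \ insert z B) = Y := by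
    intro Y hYW
    ext e
    rw [Finset.mem_inter, Finset.mem_union]
    constructor
    · rintro ⟨he | he, heW⟩
      · exact absurd he (Finset.mem_sdiff.1 heW).2
      · exact he
    · intro he
      exact ⟨Or.inr he, hYW he⟩
  have hinjA : Set.InjOn (fun Y => insert z B ∪ Y) (famA : Set (Finset α)) := by
    intro Y₁ hY₁ Y₂ hY₂ heq
    rw [Finset.mem_coe] at hY₁ hY₂
    have h1 := hrecA Y₁ (hmemA Y₁ hY₁).1
    have h2 := hrecA Y₂ (hmemA Y₂ hY₂).1
    simp only at heq
    rw [← h1, ← h2, heq]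
  have htermA : ∀ Y ∈ famA, 3 / (((Y.card + 5).choose 4 : ℕ) : ℚ) ≤
      vCap M G (insert z B ∪ Y) / faceSum M G (insert z B ∪ Y) := by
    intro Y hY
    obtain ⟨hYW, hYc⟩ := hmemA Y hY
    have h := high_top_term hG hd hk hs hl hnf hB hnP hz hl0 hL1 hL' hYW (by omega) (Or.inl hYc)
    rw [if_pos hYc, one_mul] at h
    exact h
  have hsumA : topIncome (G \ insert z B).card ≤ ∑ T ∈ 𝒯A, vCap M G T / faceSum M G T := by
    rw [h𝒯A, Finset.sum_image hinjA]
    refine le_trans ?_ (Finset.sum_le_sum htermA)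
    unfold topIncome
    rw [hfamA, Finset.sum_filter]
    rw [Finset.sum_powerset_apply_card (fun i => if (G \ insert z B).card ≤ i + 3 then
      3 / (((i + 5).choose 4 : ℕ) : ℚ) else 0)]
    apply le_of_eq
    apply Finset.sum_congr rfl
    intro i _
    rw [nsmul_eq_mul]
    split_ifs
    · rfl
    · rw [mul_zero]
  -- family B: the level-seven line targets
  set D : Finset α := (G \ insert z B) ∩ clF M {x, y} with hDdef
  set O : Finset α := (G \ insert z B) \ clF M {x, y} with hOdef
  set Aℓ : Finset α := (insert z B \ coloops M G).filter (fun w => faceOk M G (insert z B) w ∧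
    clF M {x, y} ⊆ clF M ((insert z B).erase w)) with hAdef
  set Os : Finset (Finset α) := (O.powersetCard 3).filter
    (fun YO => ∀ w ∈ Aℓ, ¬ YO ⊆ clF M ((insert z B).erase w)) with hOs
  set 𝒯B : Finset (Finset α) := ((D.powersetCard 4) ×ˢ Os).image (fun p => insert z B ∪ (p.1 ∪ p.2)) with h𝒯B
  have hDW : D ⊆ G \ insert z B := Finset.inter_subset_left
  have hOW : O ⊆ G \ insert z B := Finset.sdiff_subset
  have hmemD : ∀ YD ∈ D.powersetCard 4, YD ⊆ D ∧ YD.card = 4 := fun YD hYD => Finset.mem_powersetCard.1 hYD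
  have hmemO : ∀ YO ∈ Os, YO ⊆ O ∧ YO.card = 3 ∧ ∀ w ∈ Aℓ, ¬ YO ⊆ clF M ((insert z B).erase w) :=
    fun YO hYO => by
      rw [hOs, Finset.mem_filter, Finset.mem_powersetCard] at hYO
      exact ⟨hYO.1.1, hYO.1.2, hYO.2⟩
  have h𝒯Bsub : 𝒯B ⊆ tgtSets M 5 G B z := by
    intro T hT
    rw [h𝒯B, Finset.mem_image] at hT
    obtain ⟨p, hp, rfl⟩ := hT
    rw [Finset.mem_product] at hp
    obtain ⟨hYD, hYDc⟩ := hmemD p.1 hp.1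
    obtain ⟨hYO, hYOc, -⟩ := hmemO p.2 hp.2
    rw [tgtSets_eq_image hG (mem_thinMembers.1 hB).1 hz, Finset.mem_image]
    refine ⟨p.1 ∪ p.2, Finset.mem_filter.2 ⟨Finset.mem_powerset.2
      (Finset.union_subset (hYD.trans hDW) (hYO.trans hOW)), ?_⟩, rfl⟩
    exact Finset.Nonempty.mono Finset.subset_union_left (Finset.card_pos.1 (by omega))
  have hinjB : Set.InjOn (fun p : Finset α × Finset α => insert z B ∪ (p.1 ∪ p.2))
      ((D.powersetCard 4 ×ˢ Os : Finset _) : Set _) := by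
    intro p₁ hp₁ p₂ hp₂ heq
    rw [Finset.mem_coe, Finset.mem_product] at hp₁ hp₂
    have keyD : ∀ p ∈ D.powersetCard 4 ×ˢ Os, (insert z B ∪ (p.1 ∪ p.2)) ∩ D = p.1 := by
      intro p hp
      rw [Finset.mem_product] at hp
      ext e
      rw [Finset.mem_inter, Finset.mem_union, Finset.mem_union]
      constructor
      · rintro ⟨he | he | he, heD⟩
        · exact absurd he (Finset.mem_sdiff.1 (hDW heD)).2
        · exact he
        · exact absurd (Finset.mem_inter.1 heD).2 (Finset.mem_sdiff.1 ((hmemO p.2 hp.2).1 he)).2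
      · intro he
        exact ⟨Or.inr (Or.inl he), (hmemD p.1 hp.1).1 he⟩
    have keyO : ∀ p ∈ D.powersetCard 4 ×ˢ Os, (insert z B ∪ (p.1 ∪ p.2)) ∩ O = p.2 := by
      intro p hp
      rw [Finset.mem_product] at hp
      ext e
      rw [Finset.mem_inter, Finset.mem_union, Finset.mem_union]
      constructor
      · rintro ⟨he | he | he, heO⟩
        · exact absurd he (Finset.mem_sdiff.1 (hOW heO)).2
        · exact absurd (Finset.mem_inter.1 ((hmemD p.1 hp.1).1 he)).2 (Finset.mem_sdiff.1 heO).2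
        · exact he
      · intro he
        exact ⟨Or.inr (Or.inr he), (hmemO p.2 hp.2).1 he⟩
    have hD₁ := keyD p₁ (Finset.mem_product.2 hp₁)
    have hD₂ := keyD p₂ (Finset.mem_product.2 hp₂)
    have hO₁ := keyO p₁ (Finset.mem_product.2 hp₁)
    have hO₂ := keyO p₂ (Finset.mem_product.2 hp₂)
    simp only at heq
    apply Prod.ext
    · rw [← hD₁, ← hD₂, heq]
    · rw [← hO₁, ← hO₂, heq]
  have htermB : ∀ p ∈ D.powersetCard 4 ×ˢ Os, 11 / 18 * 3 /
      ((lineFaceBound (4 + ((insert z B \ coloops M G) ∩ clF M {x, y}).card)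
        (8 - ((insert z B \ coloops M G) ∩ clF M {x, y}).card) : ℕ) : ℚ) ≤
      vCap M G (insert z B ∪ (p.1 ∪ p.2)) / faceSum M G (insert z B ∪ (p.1 ∪ p.2)) := by
    intro p hp
    rw [Finset.mem_product] at hp
    obtain ⟨hYD, hYDc⟩ := hmemD p.1 hp.1
    obtain ⟨hYO, hYOc, hYOhit⟩ := hmemO p.2 hp.2
    have h := line_hit_term hG hd hk hs hl hnf hB hnP hz hl0 hYD (by omega) hYO (by omega) hYOhit
    rw [hYDc, hYOc] at h
    exact h
  have hC : ∀ w ∈ Aℓ, (clF M ((insert z B).erase w) ∩ O).card + 2 ≤ O.card := by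
    intro w hw
    rw [hAdef, Finset.mem_filter] at hw
    have hholes := two_le_card_holes hG hnf hQG hw.2.1
    have hsub : (G \ insert z B) \ clF M ((insert z B).erase w) ⊆ O \ clF M ((insert z B).erase w) := by
      intro e he
      rw [Finset.mem_sdiff] at he ⊢
      exact ⟨Finset.mem_sdiff.2 ⟨he.1, fun hel => he.2 (hw.2.2 hel)⟩, he.2⟩
    have h1 := Finset.card_le_card hsub
    have h2 := Finset.card_sdiff_add_card_inter O (clF M ((insert z B).erase w))
    rw [Finset.inter_comm]
    omega
  have hcount := card_filter_forall_not_subset_ge O Aℓ (fun w => clF M ((insert z B).erase w)) hC 3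
  have hsumB : levelSevenIncome ((insert z B \ coloops M G) ∩ clF M {x, y}).card D.card O.card ≤
      ∑ T ∈ 𝒯B, vCap M G T / faceSum M G T := by
    rw [h𝒯B, Finset.sum_image hinjB]
    refine le_trans ?_ (Finset.sum_le_sum htermB)
    rw [Finset.sum_const, Finset.card_product, Finset.card_powersetCard, nsmul_eq_mul]
    unfold levelSevenIncome
    have hA3' : (Aℓ.card : ℚ) ≤ 3 := by exact_mod_cast hA3
    have h0 : (0 : ℚ) ≤ (((O.card - 2).choose 3 : ℕ) : ℚ) := by positivity
    have hmax : max 0 (((O.card.choose 3 : ℕ) : ℚ) - 3 * (((O.card - 2).choose 3 : ℕ) : ℚ)) ≤ (Os.card : ℚ) := by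
      apply max_le (by positivity)
      nlinarith
    have hF : (0 : ℚ) ≤ 11 / 18 * 3 / ((lineFaceBound (4 + ((insert z B \ coloops M G) ∩ clF M {x, y}).card)
        (8 - ((insert z B \ coloops M G) ∩ clF M {x, y}).card) : ℕ) : ℚ) := by positivity
    have hD0 : (0 : ℚ) ≤ ((D.card.choose 4 : ℕ) : ℚ) := by positivity
    push_cast
    calc ((D.card.choose 4 : ℕ) : ℚ) * (11 / 18 * max 0 (((O.card.choose 3 : ℕ) : ℚ) -
          3 * (((O.card - 2).choose 3 : ℕ) : ℚ)) * 3 /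
          ((lineFaceBound (4 + ((insert z B \ coloops M G) ∩ clF M {x, y}).card)
            (8 - ((insert z B \ coloops M G) ∩ clF M {x, y}).card) : ℕ) : ℚ))
        = ((D.card.choose 4 : ℕ) : ℚ) * (max 0 (((O.card.choose 3 : ℕ) : ℚ) -
          3 * (((O.card - 2).choose 3 : ℕ) : ℚ)) * (11 / 18 * 3 /
          ((lineFaceBound (4 + ((insert z B \ coloops M G) ∩ clF M {x, y}).card)
            (8 - ((insert z B \ coloops M G) ∩ clF M {x, y}).card) : ℕ) : ℚ))) := by ring
      _ ≤ ((D.card.choose 4 : ℕ) : ℚ) * ((Os.card : ℚ) * (11 / 18 * 3 /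
          ((lineFaceBound (4 + ((insert z B \ coloops M G) ∩ clF M {x, y}).card)
            (8 - ((insert z B \ coloops M G) ∩ clF M {x, y}).card) : ℕ) : ℚ))) :=
          mul_le_mul_of_nonneg_left (mul_le_mul_of_nonneg_right hmax hF) hD0
      _ = ((D.card.choose 4 : ℕ) : ℚ) * (Os.card : ℚ) * (11 / 18 * 3 /
          ((lineFaceBound (4 + ((insert z B \ coloops M G) ∩ clF M {x, y}).card)
            (8 - ((insert z B \ coloops M G) ∩ clF M {x, y}).card) : ℕ) : ℚ)) := by ring
  -- the two families are disjoint: `|T ∩ W| ≥ N − 3 ≥ 8` against `|T ∩ W| = 7`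
  have hdisj : Disjoint 𝒯A 𝒯B := by
    rw [Finset.disjoint_left]
    intro T hTA hTB
    rw [h𝒯A, Finset.mem_image] at hTA
    rw [h𝒯B, Finset.mem_image] at hTB
    obtain ⟨Y, hY, rfl⟩ := hTA
    obtain ⟨p, hp, heq⟩ := hTB
    rw [Finset.mem_product] at hp
    obtain ⟨hYW, hYc⟩ := hmemA Y hY
    obtain ⟨hYD, hYDc⟩ := hmemD p.1 hp.1
    obtain ⟨hYO, hYOc, -⟩ := hmemO p.2 hp.2
    have h1 := hrecA Y hYW
    have h2 := hrecA (p.1 ∪ p.2) (Finset.union_subset (hYD.trans hDW) (hYO.trans hOW))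
    rw [heq] at h2
    have hYeq : Y = p.1 ∪ p.2 := h1.symm.trans h2
    have hcard : (p.1 ∪ p.2).card ≤ 7 := by
      refine le_trans (Finset.card_union_le _ _) ?_
      omega
    rw [hYeq] at hYc
    omega
  refine ⟨𝒯A ∪ 𝒯B, Finset.union_subset h𝒯Asub h𝒯Bsub, ?_⟩
  rw [Finset.sum_union hdisj]
  exact add_le_add hsumA hsumB

/-- **THE TOP-AND-LEVEL-SEVEN THEOREM**: every line carries `≤ L ≤ N − 6` points of `W`, `N ≥ 11`, and
`1 ≤ topIncome N + levelSevenIncome q d k` for a line `cl {x, y}` ⇒ fair. -/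
theorem basis_pair_fair_of_top_and_level_seven (hG : G ∈ flatsQ M (5 + 1)) (hd : (gr M \ G).card = 2)
    (hk : kColoops M G = 1) (hs : ∀ e ∈ gr M, ∀ f ∈ gr M, e ≠ f → rkN M {e, f} = 2)
    (hl : ∀ e ∈ gr M, M.Indep {e}) (hnf : fatClosures M 5 G 2 = ∅) {B : Finset α}
    (hB : B ∈ thinMembers M 5 G) (hnP : ¬ bigP M G B) {z : α} (hz : z ∈ G \ clF M B)
    (hl0 : loss M 5 G B z ≠ 0) {L : ℕ} (hL1 : 1 ≤ L)
    (hL : ∀ x ∈ G \ insert z B, ∀ y ∈ G \ insert z B, x ≠ y →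
      ((G \ insert z B) ∩ clF M {x, y}).card ≤ L)
    (hLN : L + 6 ≤ (G \ insert z B).card) (hN : 11 ≤ (G \ insert z B).card)
    {x y : α} (hx : x ∈ G \ coloops M G) (hy : y ∈ G \ coloops M G) (hxy : x ≠ y)
    (hsum : 1 ≤ topIncome (G \ insert z B).card +
      levelSevenIncome ((insert z B \ coloops M G) ∩ clF M {x, y}).card
        ((G \ insert z B) ∩ clF M {x, y}).card ((G \ insert z B) \ clF M {x, y}).card) :
    loss M 5 G B z ≤ rhoL M 5 G B z * lossIncomeH M 5 G (bigP M G) (dshGT2 M 5 G) B z := by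
  have hfat : (fatClosures M 5 G 2).card ≤ 1 := by
    rw [hnf, Finset.card_empty]
    exact zero_le_one
  obtain ⟨𝒯, hsub, hinc⟩ := top_and_level_seven_income hG hd hk hs hl hnf hB hnP hz hl0 hL1 hL hLN hN hx hy hxy
  exact basis_pair_fair_of_vCap_face_sum_subfamily hG hd hk hs hl hfat hB hnP hz hl0 hsub (hsum.trans hinc)

/-- `topIncome 11 + levelSevenIncome q 5 6 ≥ 1` for `q ≤ 2` (`1.04 / 1.06 / 1.09`). -/
theorem one_le_top_eleven_five_six {q : ℕ} (hq : q ≤ 2) : 1 ≤ topIncome 11 + levelSevenIncome q 5 6 := by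
  interval_cases q <;>
    (unfold topIncome levelSevenIncome
     simp only [Finset.sum_range_succ, Finset.sum_range_zero]
     norm_num [lineFaceBound, Nat.choose, max_def])

/-- **The cell `(5, 6)` at `|W| = 11`**: every line carries `≤ 5` points of `W`, one line carries `5` ⇒ fair. -/
theorem basis_pair_fair_of_five_six_eleven (hG : G ∈ flatsQ M (5 + 1)) (hd : (gr M \ G).card = 2)
    (hk : kColoops M G = 1) (hs : ∀ e ∈ gr M, ∀ f ∈ gr M, e ≠ f → rkN M {e, f} = 2)
    (hl : ∀ e ∈ gr M, M.Indep {e}) (hnf : fatClosures M 5 G 2 = ∅) {B : Finset α}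
    (hB : B ∈ thinMembers M 5 G) (hnP : ¬ bigP M G B) {z : α} (hz : z ∈ G \ clF M B)
    (hl0 : loss M 5 G B z ≠ 0) (hN : (G \ insert z B).card = 11)
    (hL : ∀ x ∈ G \ insert z B, ∀ y ∈ G \ insert z B, x ≠ y →
      ((G \ insert z B) ∩ clF M {x, y}).card ≤ 5)
    {x y : α} (hx : x ∈ G \ insert z B) (hy : y ∈ G \ insert z B) (hxy : x ≠ y)
    (hd5 : ((G \ insert z B) ∩ clF M {x, y}).card = 5) :
    loss M 5 G B z ≤ rhoL M 5 G B z * lossIncomeH M 5 G (bigP M G) (dshGT2 M 5 G) B z := by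
  have hind : M.Indep ((insert z B \ coloops M G : Finset α) : Set α) :=
    (indep_insert_of_basis_pair hG hd hk hB hnP hz).subset (by exact_mod_cast (Finset.sdiff_subset))
  have hq2 := card_inter_clF_pair_le_two_of_indep hind (a := x) (b := y)
  have hsplit := Finset.card_sdiff_add_card_inter (G \ insert z B) (clF M {x, y})
  have hk6 : ((G \ insert z B) \ clF M {x, y}).card = 6 := by omega
  apply basis_pair_fair_of_top_and_level_seven hG hd hk hs hl hnf hB hnP hz hl0 (L := 5) (by norm_num) hL
    (by omega) (by omega) (mem_sdiff_coloops_of_mem_sdiff_insert hG hd hB hx)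
    (mem_sdiff_coloops_of_mem_sdiff_insert hG hd hB hy) hxy
  rw [hN, hd5, hk6]
  exact one_le_top_eleven_five_six hq2

/-- **`|W| = 11` ⇒ fair**: the longest line through two points of `W` has `≥ 7`, `6`, `5` or `≤ 4` points. -/
theorem basis_pair_fair_of_eleven (hG : G ∈ flatsQ M (5 + 1)) (hd : (gr M \ G).card = 2)
    (hk : kColoops M G = 1) (hs : ∀ e ∈ gr M, ∀ f ∈ gr M, e ≠ f → rkN M {e, f} = 2)
    (hl : ∀ e ∈ gr M, M.Indep {e}) (hnf : fatClosures M 5 G 2 = ∅) {B : Finset α}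
    (hB : B ∈ thinMembers M 5 G) (hnP : ¬ bigP M G B) {z : α} (hz : z ∈ G \ clF M B)
    (hl0 : loss M 5 G B z ≠ 0) (hN : (G \ insert z B).card = 11) :
    loss M 5 G B z ≤ rhoL M 5 G B z * lossIncomeH M 5 G (bigP M G) (dshGT2 M 5 G) B z := by
  by_cases h7 : ∃ x ∈ G \ insert z B, ∃ y ∈ G \ insert z B, x ≠ y ∧
      7 ≤ ((G \ insert z B) ∩ clF M {x, y}).card
  · obtain ⟨x, hx, y, hy, hxy, hd7⟩ := h7
    exact basis_pair_fair_of_eleven_seven_collinear hG hd hk hs hl hnf hB hnP hz hl0 hN hx hy hxy hd7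
  · by_cases h6 : ∃ x ∈ G \ insert z B, ∃ y ∈ G \ insert z B, x ≠ y ∧
        6 ≤ ((G \ insert z B) ∩ clF M {x, y}).card
    · obtain ⟨x, hx, y, hy, hxy, hd6⟩ := h6
      have hlt7 : ((G \ insert z B) ∩ clF M {x, y}).card < 7 := by
        by_contra h
        exact h7 ⟨x, hx, y, hy, hxy, by omega⟩
      have hsplit := Finset.card_sdiff_add_card_inter (G \ insert z B) (clF M {x, y})
      exact basis_pair_fair_of_six_five hG hd hk hs hl hnf hB hnP hz hl0
        (mem_sdiff_coloops_of_mem_sdiff_insert hG hd hB hx) (mem_sdiff_coloops_of_mem_sdiff_insert hG hd hB hy)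
        hxy (by omega) (by omega)
    · by_cases h5 : ∃ x ∈ G \ insert z B, ∃ y ∈ G \ insert z B, x ≠ y ∧
          5 ≤ ((G \ insert z B) ∩ clF M {x, y}).card
      · obtain ⟨x, hx, y, hy, hxy, hd5⟩ := h5
        have hlt6 : ((G \ insert z B) ∩ clF M {x, y}).card < 6 := by
          by_contra h
          exact h6 ⟨x, hx, y, hy, hxy, by omega⟩
        apply basis_pair_fair_of_five_six_eleven hG hd hk hs hl hnf hB hnP hz hl0 hN ?_ hx hy hxy (by omega)
        intro x' hx' y' hy' hxy'
        by_contra h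
        exact h6 ⟨x', hx', y', hy', hxy', by omega⟩
      · apply basis_pair_fair_of_eleven_lines_le_four hG hd hk hs hl hnf hB hnP hz hl0 ?_ hN
        intro x' hx' y' hy' hxy'
        by_contra h
        exact h5 ⟨x', hx', y', hy', hxy', by omega⟩

/-- **The cell `(2, 1)` with no fat closure satisfies the local Hall inequality for `|G| ≥ 17`.** -/
theorem localShadowHall_nonfat_of_seventeen (hG : G ∈ flatsQ M (5 + 1)) (hd : (gr M \ G).card = 2)
    (hk : kColoops M G = 1) (hs : ∀ e ∈ gr M, ∀ f ∈ gr M, e ≠ f → rkN M {e, f} = 2)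
    (hl : ∀ e ∈ gr M, M.Indep {e}) (hnf : fatClosures M 5 G 2 = ∅) (h17 : 17 ≤ G.card) :
    LocalShadowHall M 5 G := by
  rcases Nat.lt_or_ge G.card 18 with h17' | h18
  · have hfat : (fatClosures M 5 G 2).card ≤ 1 := by
      rw [hnf, Finset.card_empty]
      exact zero_le_one
    apply localShadowHall_of_gt2_of_basis_fair hG hd hk hs hl hfat
    intro B hB hnP z hz
    by_cases hl0 : loss M 5 G B z = 0
    · rw [hl0]
      have hd' : (gr M \ G).card ≤ 5 := by omega
      have h1 : 0 ≤ rhoL M 5 G B z := by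
        unfold rhoL
        rw [hl0]
        simp
      have h2 : 0 ≤ lossIncomeH M 5 G (bigP M G) (dshGT2 M 5 G) B z :=
        lossIncomeH_nonneg hG hd' (column_side_gt2 hG hd hk hs hl hfat) B z
      positivity
    · apply basis_pair_fair_of_eleven hG hd hk hs hl hnf hB hnP hz hl0
      rw [card_sdiff_insert_eq_card_sub_six hG hd hk hB hnP hz]
      omega
  · exact localShadowHall_nonfat_of_eighteen hG hd hk hs hl hnf h18

/-- **h21's cell `(2, 1)` for every `|G| ≥ 17`**: at least two fat closures (gen 28), exactly one (gen 36), or none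
(`localShadowHall_nonfat_of_seventeen`). -/
theorem localShadowHall_two_one_of_seventeen (hG : G ∈ flatsQ M (5 + 1)) (hd : (gr M \ G).card = 2)
    (hk : kColoops M G = 1) (hs : ∀ e ∈ gr M, ∀ f ∈ gr M, e ≠ f → rkN M {e, f} = 2)
    (hl : ∀ e ∈ gr M, M.Indep {e}) (h17 : 17 ≤ G.card) : LocalShadowHall M 5 G := by
  rcases Nat.lt_or_ge (fatClosures M 5 G 2).card 2 with hlt | hge
  · rcases Nat.lt_or_ge (fatClosures M 5 G 2).card 1 with h0 | h1
    · have hnf : fatClosures M 5 G 2 = ∅ := Finset.card_eq_zero.1 (by omega)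
      exact localShadowHall_nonfat_of_seventeen hG hd hk hs hl hnf h17
    · obtain ⟨B₀, hB₀, hm₀⟩ := exists_fat_member_of_card_eq_one hG hd (by omega)
      exact localShadowHall_fat hG hd hk hs hl (by omega) hB₀ hm₀
  · exact localShadowHall_two_one_five_fatClosures_free hG hd hk hs hl hge

end PercRepro.Shadow
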